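import Summits.CriticalPhenomena.PercolationContinuityZ3.Theorems.Transplant.FKConnectivityAllQForestContractionMono
import Summits.CriticalPhenomena.PercolationContinuityZ3.Theorems.Transplant.FKConnectivityAllQForestAdjacentTwoSumSameSideFibres
import HarnessLib

/-!
# ABSORPTION MONOTONICITY of the one-class hub-pair sum (node `HubPairAbsorptionMonoOn`, NOT asserted) and three exact identities of the
# one-class sum: the ADJACENT case (= the margin of the pinned fibre), the case `a = v` (= 0, swap-all-but-`e` involution), and
# the DOUBLED-`e` equality `bad = good`

Support file (`--supports stmt-CriticalPhenomena-4575`), FK sub-lane `prim-bschramm-fk-1` (gen 25) of the post-continuity programme;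
builds on p205010 (kernel theorem, internal audit signed; external expert review pending).  One `@[conjecture]`-shaped counting node with its `Pos`
form (NOT asserted), no named facts, no sorries; standard axioms.  Companion of `…ForestHubPairDecomposition` (p366299: the one-edge decomposition
`margin = 2·margin(pinned) + s_A` and the arrow (★) `HubPairOneClassOn V → AdjForestRayleighNoSqOn V`); this file is written against the older
imports only (the reachability events are spelled out as `{ω | (openGraph ω).Reachable o a}`), so that it elaborates independently.

NOTATION.  Fibre `(M, u₀)`: first class `ω ⊇ u₀`, second class `ω ∆ M ⊇ u₀`; `e = ov`, `f = oy`; for a vertex `a` the ONE-CLASS TYPE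
`T_A(o,a) := {a reachable from o in the first class and not in the second}` and the four counts on it
`sRR = #(e,f first)`, `sBB = #(e,f second)`, `dRB = #(e first, f second)`, `dBR = #(f first, e second)`; `s_A := dRB + dBR − sRR − sBB`.

1. **`hubPair_oneClass_eq_pinned_of_adjacent`**, **`hubPair_counts_eq_pinned_of_adjacent`** (F2): if a free pair `g = o'a' ∉ {e,f}` joins the pinned class of `o` to the pinned class of `a`, then on
   `T_A(o,a)` the pair `g` is in the first class and the second class does not join its ends, so `ω ↦ ω` identifies `T_A(o,a) ∩ (P | Q)` on `(M,u₀)` with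
   `(P | Q)` on the PINNED fibre `(M ∖ g, u₀ ∪ g)`: each of the four counts equals the corresponding unconditioned count there; in particular
   `s_A(M,u₀; o,a) = margin(M∖g, u₀+g)` — the one-class sum at an ADJACENT vertex is the margin of a fibre with fewer free pairs.
2. **`hubPair_sRR_eq_dRB_at_v`**, **`hubPair_second_e_eq_zero_at_v`** (F3): at `a = v` the involution "swap every free pair except `e`"
   (`ω ↦ (ω ∆ M) ∪ {e}`, valid exactly on `T_A(o,v)`) gives `sRR = dRB`, and the two counts with `e` in the second class vanish; so `s_A(o, v) = 0` —
   (★) holds with equality at `a = v` (**`hubPairOneClass_at_v`**).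
3. **`adjForestNoSq_bad_eq_good_of_parallel`** (F6; with `not_mem_of_parallel`, `isForestCfg_exchange_parallel`, `exchange_fibre_facts`): if a free pair `e' ≠ e` joins the pinned classes of `o` and `v` ("`e` doubled in the quotient"), then
   `bad = good` (involution `ω ↦ ω ∆ {e, e'}` on `{e ∈ ω}` followed by the global swap).
4. NEW NODE — **ABSORPTION MONOTONICITY `HubPairAbsorptionMonoOn V`** (AAM; NOT asserted): for every fibre, all `o`, `v ≠ y`, `a`, and every free pair
   `h = az ∉ {e,f}` at `a` with `z ∉ {o,v,y}`:  `s_A(M, u₀; o, a) ≥ s_A(M ∖ h, u₀ ∪ h; o, a)` — absorbing a neighbour into `a` (pinning `h`) does not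
   increase the one-class sum.  EVIDENCE (exact; numerics/starcm/samono2.c exhaustive over connected simple graphs with `a` not adjacent to `o`, plus
   aam_multi.py / samono14 on multigraphs, the W(k;t) family to n = 13, the 18 CM-violating graphs of g24, 1,000 random graphs n = 10–12):
   0 failures in 1,572,854 (n ≤ 8), 26,689,062 (n = 9), 36,111 (multigraphs), 5,768 + 11,604 + 611,470 (families / random); kit j197933 = n = 10.
   The same engine shows that pinning a pair FAR from `a` can increase `s_A` (2,493 / 53.4 M at n = 9), so the monotonicity is specific to the far
   endpoint.  With the adjacency included (no hypothesis `a ≁ o` here) the node also contains the star instances `margin(X) ≥ margin(X/h)` of g24's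
   STAR-CM (0 failures n ≤ 10), which (★) implies.
WHY (memo bschramm/FROM-fk-1-g25-HUB-PAIR-DECOMPOSITION.md §6): AAM ⇒ (★) ⇒ (♣)⁰ by one strong induction on the free pairs — absorb neighbours of `a`
until `a` meets the hub (then item 1 turns `s_A` into a margin with fewer pairs), or is isolated (`s_A = 0`), or hangs on `v, y` only (then `s_A` is half a
margin with fewer pairs by the one-edge decomposition and item 3); the first-step exception `N(a) = {o,v,y}` is the locally-connected theorem
(`adjForestNoSq_fibre_of_linkReachable`).  The kernel arrow itself needs the quotient form of that theorem and is NOT in this file.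
[cite: SempleWelsh2008, Conj. 1.1 (p. 2); Thm. 4.2 (p. 11)] [cite: CibulkaHladkyLaCroixWagner2008, Thm. 1 (p. 2)] [cite: Linusson2011, Prop. 2.6]
[cite: Grimmett2006, §1.5 (p. 13)]
-/

noncomputable section

namespace Summit.CriticalPhenomena.PercolationContinuityZ3.Theorems
namespace FK

open Set Literature.Probability.LatticeModels Literature.Probability.Percolation
open scoped Classical symmDiff

variable {V : Type*} [Fintype V]

/-- **ABSORPTION MONOTONICITY of the one-class hub-pair sum (AAM) on the vertex type `V`**: for every fibre `(M,u₀)`, all `o`, `v ≠ y`, `a`, and every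
free pair `h = az ∉ {ov, oy}` with `z ∉ {o, v, y}`, the one-class sum `s_A = dRB + dBR − sRR − sBB` on
`T_A(o,a) = {a reachable from o in the first class, not in the second}` does not increase when `h` is pinned:
`(dRB + dBR + sRR' + sBB')(…) ≥ (dRB' + dBR' + sRR + sBB)(…)` (primes = the fibre `(M ∖ h, u₀ ∪ h)`).  CONJECTURE-SHAPED COUNTING STATEMENT, NOT asserted.
[cite: SempleWelsh2008, Conj. 1.1 (p. 2)] [cite: Linusson2011, Prop. 2.6] -/
def HubPairAbsorptionMonoOn (V : Type*) [Fintype V] : Prop :=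
  ∀ (M u₀ : BondConfig V), Disjoint u₀ M → ∀ (o v y a z : V), v ≠ y → z ≠ o → z ≠ v → z ≠ y →
    s(a, z) ∈ M → s(a, z) ≠ s(o, v) → s(a, z) ≠ s(o, y) →
    -- s_A of the pinned fibre ≤ s_A of the fibre, in ℕ:
    fibreCount (M \ {s(a, z)}) (insert s(a, z) u₀) (forestEv V ∩ {ω | s(o, v) ∈ ω} ∩ {ω | (openGraph ω).Reachable o a})
          (forestEv V ∩ {ω | s(o, y) ∈ ω} ∩ {ω | ¬ (openGraph ω).Reachable o a}) +
        fibreCount (M \ {s(a, z)}) (insert s(a, z) u₀) (forestEv V ∩ {ω | s(o, y) ∈ ω} ∩ {ω | (openGraph ω).Reachable o a})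
          (forestEv V ∩ {ω | s(o, v) ∈ ω} ∩ {ω | ¬ (openGraph ω).Reachable o a}) +
        fibreCount M u₀ (forestEv V ∩ {ω | s(o, v) ∈ ω ∧ s(o, y) ∈ ω} ∩ {ω | (openGraph ω).Reachable o a})
          (forestEv V ∩ {ω | ¬ (openGraph ω).Reachable o a}) +
        fibreCount M u₀ (forestEv V ∩ {ω | (openGraph ω).Reachable o a})
          (forestEv V ∩ {ω | s(o, v) ∈ ω ∧ s(o, y) ∈ ω} ∩ {ω | ¬ (openGraph ω).Reachable o a}) ≤
      fibreCount M u₀ (forestEv V ∩ {ω | s(o, v) ∈ ω} ∩ {ω | (openGraph ω).Reachable o a})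
          (forestEv V ∩ {ω | s(o, y) ∈ ω} ∩ {ω | ¬ (openGraph ω).Reachable o a}) +
        fibreCount M u₀ (forestEv V ∩ {ω | s(o, y) ∈ ω} ∩ {ω | (openGraph ω).Reachable o a})
          (forestEv V ∩ {ω | s(o, v) ∈ ω} ∩ {ω | ¬ (openGraph ω).Reachable o a}) +
        fibreCount (M \ {s(a, z)}) (insert s(a, z) u₀) (forestEv V ∩ {ω | s(o, v) ∈ ω ∧ s(o, y) ∈ ω} ∩ {ω | (openGraph ω).Reachable o a})
          (forestEv V ∩ {ω | ¬ (openGraph ω).Reachable o a}) +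
        fibreCount (M \ {s(a, z)}) (insert s(a, z) u₀) (forestEv V ∩ {ω | (openGraph ω).Reachable o a})
          (forestEv V ∩ {ω | s(o, v) ∈ ω ∧ s(o, y) ∈ ω} ∩ {ω | ¬ (openGraph ω).Reachable o a})

/-- **Absorption monotonicity on every finite vertex type.**  CONJECTURE-SHAPED, NOT asserted (evidence in the module docstring).
[cite: SempleWelsh2008, Conj. 1.1 (p. 2); Thm. 4.2 (p. 11)] -/
@[conjecture] def HubPairAbsorptionMonoPos : Prop := ∀ n : ℕ, HubPairAbsorptionMonoOn (Fin n)

/-! ### Common facts about a configuration of a fibre -/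

section Common

variable {M u₀ ω : BondConfig V}

omit [Fintype V] in
/-- The pinned pairs lie in every configuration of the fibre. [folklore] -/
theorem pinned_subset_of_fibre (hω : ω \ M = u₀) : u₀ ⊆ ω := fun p hp => by
  have hp' : p ∈ ω \ M := by rw [hω]; exact hp
  exact hp'.1

omit [Fintype V] in
/-- The pinned pairs lie in every partner. [folklore] -/
theorem pinned_subset_partner_of_fibre (hd : Disjoint u₀ M) (hω : ω \ M = u₀) : u₀ ⊆ ω ∆ M := fun _ hp =>
  Set.mem_symmDiff.2 (Or.inl ⟨pinned_subset_of_fibre hω hp, fun hpM => hd.le_bot ⟨hp, hpM⟩⟩)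

omit [Fintype V] in
/-- A free pair lies in the configuration iff it does not lie in the partner. [folklore] -/
theorem mem_partner_iff_of_free {g : Sym2 V} (hgM : g ∈ M) : g ∈ ω ∆ M ↔ g ∉ ω := by
  rw [Set.mem_symmDiff]
  constructor
  · rintro (⟨_, h⟩ | ⟨_, h⟩)
    · exact absurd hgM h
    · exact h
  · exact fun h => Or.inr ⟨hgM, h⟩

end Common

/-! ### F2: the adjacent case is the pinned fibre -/

section Adjacent

variable {M u₀ : BondConfig V} {o v y a o' a' : V} {g : Sym2 V}

/-- **F2 — at a vertex ADJACENT to the hub class the one-class type is the pinned fibre.**  If the free pair `g = o'a'` joins the pinned class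
of `o` to the pinned class of `a`, then for every first-class event `P` and every second-class event `Q₀` insensitive to `g`:
`#_{(M,u₀)}(P ∩ {o ~ a}, Fo ∩ Q₀ ∩ {o ≁ a}) = #_{(M∖g, u₀+g)}(P, Fo ∩ Q₀)` (the map is the identity on configurations).
[cite: Linusson2011, Prop. 2.6] [cite: Grimmett2006, §1.5 (p. 13)] -/
theorem hubPair_oneClass_eq_pinned_of_adjacent (hd : Disjoint u₀ M) (hgM : g ∈ M) (hg : g = s(o', a')) (hoa' : o' ≠ a')
    (ho : (openGraph u₀).Reachable o o') (ha : (openGraph u₀).Reachable a a')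
    (P : Set (BondConfig V)) {Q₀ : Set (BondConfig V)} (hQ : ∀ ζ : BondConfig V, g ∉ ζ → (insert g ζ ∈ Q₀ ↔ ζ ∈ Q₀)) :
    fibreCount M u₀ (P ∩ {ω | (openGraph ω).Reachable o a}) (forestEv V ∩ Q₀ ∩ {ω | ¬ (openGraph ω).Reachable o a}) =
      fibreCount (M \ {g}) (insert g u₀) P (forestEv V ∩ Q₀) := by
  have hgu : g ∉ u₀ := fun h => hd.le_bot ⟨h, hgM⟩
  -- the partner of the pinned fibre is the old partner plus `g`, whenever `g ∈ ω`
  have hpartner : ∀ ω : BondConfig V, g ∈ ω → ω ∆ (M \ {g}) = insert g (ω ∆ M) := by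
    intro ω hgω
    ext p
    simp only [Set.mem_symmDiff, mem_sdiff, mem_singleton_iff, mem_insert_iff]
    constructor
    · rintro (⟨hpω, hpn⟩ | ⟨⟨hpM, hpg⟩, hpω⟩)
      · by_cases hpg : p = g
        · exact Or.inl hpg
        · exact Or.inr (Or.inl ⟨hpω, fun hpM => hpn ⟨hpM, hpg⟩⟩)
      · exact Or.inr (Or.inr ⟨hpM, hpω⟩)
    · rintro (rfl | ⟨hpω, hpM⟩ | ⟨hpM, hpω⟩)
      · exact Or.inl ⟨hgω, fun h => h.2 rfl⟩
      · exact Or.inl ⟨hpω, fun h => hpM h.1⟩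
      · exact Or.inr ⟨⟨hpM, fun hpg => hpω (hpg ▸ hgω)⟩, hpω⟩
  -- joining `o'` to `a'` in a class containing the pinned pairs joins `o` to `a`, and conversely
  have hjoin : ∀ β : BondConfig V, u₀ ⊆ β →
      ((openGraph β).Reachable o' a' → (openGraph β).Reachable o a) ∧
      ((openGraph β).Reachable o a → g ∉ β → IsForestCfg (insert g β) → False) := by
    intro β hβ
    have h1 : (openGraph β).Reachable o o' := ho.mono (openGraph_mono hβ)
    have h2 : (openGraph β).Reachable a a' := ha.mono (openGraph_mono hβ)
    refine ⟨fun h => h1.trans (h.trans h2.symm), fun h hgβ hF => ?_⟩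
    have hr : (openGraph β).Reachable o' a' := (h1.symm.trans h).trans h2
    exact ((isForestCfg_insert_iff hoa' (hg ▸ hgβ)).1 (hg ▸ hF)).2 hr
  refine fibreCount_eq_of_bij id id (fun ω hω hA hB => ?_) (fun ω hω hA hB => ?_)
  · -- forward
    obtain ⟨hP, hreach⟩ := hA
    obtain ⟨⟨hBF, hBQ⟩, hnreach⟩ := hB
    have hsub' := pinned_subset_partner_of_fibre hd hω
    have hgB : g ∉ ω ∆ M := by
      intro hgB
      apply hnreach
      have h3 : (openGraph (ω ∆ M)).Adj o' a' := (openGraph_adj _ _ _).2 ⟨hg ▸ hgB, hoa'⟩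
      exact ((hjoin _ hsub').1) h3.reachable
    have hgω : g ∈ ω := by
      by_contra hgω; exact hgB ((mem_partner_iff_of_free hgM).2 hgω)
    have hfib : ω \ (M \ {g}) = insert g u₀ := by
      ext p
      simp only [mem_sdiff, mem_singleton_iff, mem_insert_iff]
      constructor
      · rintro ⟨hpω, hpn⟩
        by_cases hpg : p = g
        · exact Or.inl hpg
        · right; have : p ∈ ω \ M := ⟨hpω, fun hpM => hpn ⟨hpM, hpg⟩⟩; rw [hω] at this; exact this
      · rintro (rfl | hpu)
        · exact ⟨hgω, fun h => h.2 rfl⟩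
        · exact ⟨pinned_subset_of_fibre hω hpu, fun h => hd.le_bot ⟨hpu, h.1⟩⟩
    have hnreach' : ¬ (openGraph (ω ∆ M)).Reachable o' a' := fun h => hnreach ((hjoin _ hsub').1 h)
    refine ⟨hfib, hP, ?_, rfl⟩
    show ω ∆ (M \ {g}) ∈ forestEv V ∩ Q₀
    rw [hpartner ω hgω]
    exact ⟨(isForestCfg_insert_iff hoa' (hg ▸ hgB)).2 ⟨hBF, hnreach'⟩ |> (hg ▸ ·), (hQ _ hgB).2 hBQ⟩
  · -- backward
    have hgω : g ∈ ω := by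
      have : g ∈ ω \ (M \ {g}) := by rw [hω]; exact mem_insert _ _
      exact this.1
    have hsub : insert g u₀ ⊆ ω := pinned_subset_of_fibre hω
    have hu₀ω : u₀ ⊆ ω := fun p hp => hsub (mem_insert_of_mem _ hp)
    have hfib : ω \ M = u₀ := by
      ext p
      constructor
      · rintro ⟨hpω, hpM⟩
        have : p ∈ ω \ (M \ {g}) := ⟨hpω, fun h => hpM h.1⟩
        rw [hω] at this
        rcases this with rfl | hpu
        · exact absurd hgM hpM
        · exact hpu
      · intro hpu; exact ⟨hu₀ω hpu, fun hpM => hd.le_bot ⟨hpu, hpM⟩⟩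
    have hgB : g ∉ ω ∆ M := fun h => ((mem_partner_iff_of_free hgM).1 h) hgω
    have hB' : insert g (ω ∆ M) ∈ forestEv V ∩ Q₀ := by rw [← hpartner ω hgω]; exact hB
    have hsub' : u₀ ⊆ ω ∆ M := pinned_subset_partner_of_fibre hd hfib
    have hreach : (openGraph ω).Reachable o a := by
      have h3 : (openGraph ω).Adj o' a' := (openGraph_adj _ _ _).2 ⟨hg ▸ hgω, hoa'⟩
      exact (hjoin _ hu₀ω).1 h3.reachable
    have hnreach : ¬ (openGraph (ω ∆ M)).Reachable o a := fun hr => (hjoin _ hsub').2 hr hgB hB'.1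
    refine ⟨hfib, ⟨hA, hreach⟩, ⟨⟨?_, (hQ _ hgB).1 hB'.2⟩, hnreach⟩, rfl⟩
    exact ⟨fun p hp => hB'.1.1 p (mem_insert_of_mem _ hp), hB'.1.2.anti (openGraph_mono (subset_insert _ _))⟩

/-- **F2 for the four one-class counts**: with `g` as above and `g ∉ {e, f}`, `sRR, dRB, dBR, sBB` at `(o,a)` on `(M,u₀)` are `bad, good, good∘swap, bad∘swap`
of the pinned fibre `(M∖g, u₀+g)`; in particular `s_A(M,u₀;o,a) = 2·(good − bad)(M∖g, u₀+g)`… stated as the four equalities.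
[cite: SempleWelsh2008, Conj. 1.1 (p. 2)] [cite: Linusson2011, Prop. 2.6] -/
theorem hubPair_counts_eq_pinned_of_adjacent (hd : Disjoint u₀ M) (hgM : g ∈ M) (hg : g = s(o', a')) (hoa' : o' ≠ a')
    (ho : (openGraph u₀).Reachable o o') (ha : (openGraph u₀).Reachable a a') (hge : g ≠ s(o, v)) (hgf : g ≠ s(o, y)) :
    fibreCount M u₀ (forestEv V ∩ {ω | s(o, v) ∈ ω ∧ s(o, y) ∈ ω} ∩ {ω | (openGraph ω).Reachable o a})
        (forestEv V ∩ {ω | ¬ (openGraph ω).Reachable o a}) =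
      fibreCount (M \ {g}) (insert g u₀) (forestEv V ∩ {ω | s(o, v) ∈ ω ∧ s(o, y) ∈ ω}) (forestEv V) ∧
    fibreCount M u₀ (forestEv V ∩ {ω | s(o, v) ∈ ω} ∩ {ω | (openGraph ω).Reachable o a})
        (forestEv V ∩ {ω | s(o, y) ∈ ω} ∩ {ω | ¬ (openGraph ω).Reachable o a}) =
      fibreCount (M \ {g}) (insert g u₀) (forestEv V ∩ {ω | s(o, v) ∈ ω}) (forestEv V ∩ {ω | s(o, y) ∈ ω}) ∧
    fibreCount M u₀ (forestEv V ∩ {ω | s(o, y) ∈ ω} ∩ {ω | (openGraph ω).Reachable o a})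
        (forestEv V ∩ {ω | s(o, v) ∈ ω} ∩ {ω | ¬ (openGraph ω).Reachable o a}) =
      fibreCount (M \ {g}) (insert g u₀) (forestEv V ∩ {ω | s(o, y) ∈ ω}) (forestEv V ∩ {ω | s(o, v) ∈ ω}) ∧
    fibreCount M u₀ (forestEv V ∩ {ω | (openGraph ω).Reachable o a})
        (forestEv V ∩ {ω | s(o, v) ∈ ω ∧ s(o, y) ∈ ω} ∩ {ω | ¬ (openGraph ω).Reachable o a}) =
      fibreCount (M \ {g}) (insert g u₀) (forestEv V) (forestEv V ∩ {ω | s(o, v) ∈ ω ∧ s(o, y) ∈ ω}) := by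
  have ie : ∀ ζ : BondConfig V, g ∉ ζ → (insert g ζ ∈ {ω : BondConfig V | s(o, v) ∈ ω} ↔ ζ ∈ {ω : BondConfig V | s(o, v) ∈ ω}) :=
    fun ζ _ => by
      simp only [mem_setOf_eq, mem_insert_iff]
      exact ⟨fun h => h.resolve_left fun h' => hge h'.symm, Or.inr⟩
  have if_ : ∀ ζ : BondConfig V, g ∉ ζ → (insert g ζ ∈ {ω : BondConfig V | s(o, y) ∈ ω} ↔ ζ ∈ {ω : BondConfig V | s(o, y) ∈ ω}) :=
    fun ζ _ => by
      simp only [mem_setOf_eq, mem_insert_iff]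
      exact ⟨fun h => h.resolve_left fun h' => hgf h'.symm, Or.inr⟩
  have ief : ∀ ζ : BondConfig V, g ∉ ζ →
      (insert g ζ ∈ {ω : BondConfig V | s(o, v) ∈ ω ∧ s(o, y) ∈ ω} ↔ ζ ∈ {ω : BondConfig V | s(o, v) ∈ ω ∧ s(o, y) ∈ ω}) :=
    fun ζ hζ => by
      simp only [mem_setOf_eq]
      exact ⟨fun h => ⟨(ie ζ hζ).1 h.1, (if_ ζ hζ).1 h.2⟩, fun h => ⟨(ie ζ hζ).2 h.1, (if_ ζ hζ).2 h.2⟩⟩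
  have iu : ∀ ζ : BondConfig V, g ∉ ζ → (insert g ζ ∈ (univ : Set (BondConfig V)) ↔ ζ ∈ (univ : Set (BondConfig V))) :=
    fun _ _ => by simp only [mem_univ]
  refine ⟨?_, ?_, ?_, ?_⟩
  · have h := hubPair_oneClass_eq_pinned_of_adjacent (a := a) hd hgM hg hoa' ho ha (forestEv V ∩ {ω | s(o, v) ∈ ω ∧ s(o, y) ∈ ω}) iu
    simp only [inter_univ] at h; exact h
  · exact hubPair_oneClass_eq_pinned_of_adjacent (a := a) hd hgM hg hoa' ho ha (forestEv V ∩ {ω | s(o, v) ∈ ω}) if_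
  · exact hubPair_oneClass_eq_pinned_of_adjacent (a := a) hd hgM hg hoa' ho ha (forestEv V ∩ {ω | s(o, y) ∈ ω}) ie
  · exact hubPair_oneClass_eq_pinned_of_adjacent (a := a) hd hgM hg hoa' ho ha (forestEv V) ief

end Adjacent

end FK
end Summit.CriticalPhenomena.PercolationContinuityZ3.Theorems

end
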